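import Mathlib
import HarnessLib
import Summits.NavierStokesRegularity.NavierStokesRegularity.Theses.LocalHelicityTubeDoor
import Summits.NavierStokesRegularity.NavierStokesRegularity.Theorems.LocalHelicityTubeDoorTarget
import Summits.NavierStokesRegularity.NavierStokesRegularity.Theorems.LocalHelicityTubeDoorFrobeniusWindowRigidityWindow
import Summits.NavierStokesRegularity.NavierStokesRegularity.Theorems.LocalHelicityTubeDoorFrobeniusProfileRigiditySharper
import Summits.NavierStokesRegularity.NavierStokesRegularity.Theorems.LocalHelicityTubeDoorFrobeniusProfileRigidityScrewSlice

/-!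
# LINE `birth` (slice quadrichotomy S12) of crux K2⁗ `Summit.NavierStokesRegularity.NavierStokesRegularity.Theses.LocalHelicityTubeDoor.FrobeniusProfileRigidity`
(stmt-NavierStokesRegularity-19975, route LocalHelicityTubeDoor OPEN rev 2) — lead nsreg-p6 g8 (claim lease 258632, 2026-08-27T07:42Z,
per DIRECTOR-NS g7 #17), skeleton v1 = nsreg-p1 g11's birth skeleton `route-helicity/bc/Lines_birth.lean` with stub 2 DISCHARGED by name.

Stubs: `stub_sliceQuadrichotomy : SliceQuadrichotomy` (OPEN — the one load-bearing classification statement; after nsreg-lit §R41/§R47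
the local germ-classification MECHANISM is withdrawn, the slice statement itself is unrefuted; critic-1 g6 p503478
`frobeniusProfileRigidity_false_without_mild`: any proof must use the Oseen–Duhamel dynamics — S12 is a statement about the dynamical class,
its proof cannot be kinematic), `stub_screwSliceRigidity : ScrewSliceRigidity` (CLOSED: the tree theorem
`…Theorems.LocalHelicityTubeDoorFrobeniusProfileRigidityScrewSlice.screwSliceRigidity`, p472222, by `exact`).  Composition
`FrobeniusProfileRigidity_of` PROVED (no sorry) and concludes the ROUTE decl by name.  Check: rc 0, sorries = 1 = `stub_sliceQuadrichotomy`.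
Helpers already landed toward stub 1 (index K2qHELPERS-19975.md, item evidence): GermQuadrichotomy p475626 (+p476563), Extremal p477139,
Sharpest p478367 (19-strata residue), ExtremalBlowDown p482400, ExtremalRecurrent p482893, HelicalSlice p472225/p473214, Strata, Sharper, Frozen.
-/

-- the summit and its single sub-problem share the name (CONVENTIONS §1)
set_option linter.dupNamespace false

namespace Summit.NavierStokesRegularity.NavierStokesRegularity.Cruxes.FrobeniusProfileRigidity.Birth

open scoped BigOperators Topology
open Filter Set Function MeasureTheory
open Summit.NavierStokesRegularity.NavierStokesRegularity.Theses.LocalHelicityTubeDoor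

noncomputable section

/-! ## BC3 — BIRTH SKELETON of the crux K2⁗ `FrobeniusProfileRigidity` (nsreg-p1 g11; line of record = the SLICE
QUADRICHOTOMY S12 of ROUND-12/13, fourth (screw) stratum added after LIT-PACK §R41 Marris–Ames 1977 (I.2)).
Two named stubs + the kernel composition `FrobeniusProfileRigidity_of` (no sorry outside the stubs). -/

open scoped RealInnerProductSpace
open Literature.Analysis Literature.Analysis.FluidPDE
open Summit.NavierStokesRegularity.NavierStokesRegularity.Theorems.LocalSineTubeDoorProfileAlignedWindowRigidityAncient
open Summit.NavierStokesRegularity.NavierStokesRegularity.Theorems.LocalSineTubeDoorProfileAlignedWindowRigidity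
open Summit.NavierStokesRegularity.NavierStokesRegularity.Theorems.PoloidalWindowDoorPoloidalWindowRigidityWindow
open Summit.NavierStokesRegularity.NavierStokesRegularity.Theorems.PoloidalWindowDoorPoloidalWindowRigidityFlat
open Summit.NavierStokesRegularity.NavierStokesRegularity.Theorems.PoloidalWindowDoorPoloidalWindowRigidityRotate
open Summit.NavierStokesRegularity.NavierStokesRegularity.Theorems.PoloidalWindowDoorPoloidalWindowRigidityAxisymmetric
open Summit.NavierStokesRegularity.NavierStokesRegularity.Theorems.PoloidalWindowDoorPoloidalWindowRigidityStrata
open Summit.NavierStokesRegularity.NavierStokesRegularity.Theorems.PoloidalWindowDoorPoloidalWindowRigidityOneSlice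
open Summit.NavierStokesRegularity.NavierStokesRegularity.Theorems.LocalHelicityTubeDoorFrobeniusProfileRigidityStrata
open Summit.NavierStokesRegularity.NavierStokesRegularity.Theorems.LocalHelicityTubeDoorFrobeniusProfileRigiditySharper

/-- The Type-I PROFILE CLASS of the door family (four clauses, verbatim from the item texts) with identically vanishing
helicity density on every slice — the hypothesis block of K2⁗. -/
def FrobeniusClass (C : ℝ) (v : ℝ → EuclideanSpace ℝ (Fin 3) → EuclideanSpace ℝ (Fin 3)) : Prop :=
  Literature.Analysis.FluidPDE.HasTypeITimeDecay C v ∧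
  ContinuousOn (Function.uncurry v) (Set.Iio (0 : ℝ) ×ˢ Set.univ) ∧
  (∀ s t : ℝ, s < t → t < 0 → ∀ x, v t x =
    Literature.Analysis.UnboundedOperators.heatExtension (v s) (t - s) x -
      Literature.Analysis.FluidPDE.oseenDuhamel 1 s v v t x) ∧
  (∀ t < 0, Literature.Analysis.FluidPDE.VectorCalculus.IsDivFree (v t)) ∧
  (∀ s < 0, ∀ y : EuclideanSpace ℝ (Fin 3), inner ℝ (v s y) (Literature.Analysis.FluidPDE.curl (v s) y) = 0)

/-- Fourth stratum, symmetry-free typing (LIT-PACK §R45): on a nonempty open set of the slice `s` the vorticity IS an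
affine screw field `k · (d × (y − c) + h · d)` with `k ≠ 0`, `d ≠ 0` (helical WITHOUT helical swirl about the axis
`c + ℝd`, pitch `h`; `h = 0` = rigid-rotation vorticity). -/
def HasScrewVorticityBall (v : ℝ → EuclideanSpace ℝ (Fin 3) → EuclideanSpace ℝ (Fin 3)) (s : ℝ) : Prop :=
  ∃ (k : ℝ) (c d : EuclideanSpace ℝ (Fin 3)) (h : ℝ) (U : Set (EuclideanSpace ℝ (Fin 3))),
    k ≠ 0 ∧ d ≠ 0 ∧ IsOpen U ∧ U.Nonempty ∧
    ∀ y ∈ U, Literature.Analysis.FluidPDE.curl (v s) y = k • (Literature.Analysis.FluidPDE.cross d (y - c) + h • d)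

/-- S12 (ROUND-13 form) — THE SLICE QUADRICHOTOMY (OPEN; the one load-bearing classification statement of the line):
a helicity-free profile of the Type-I class has SOME slice `s < 0` on which (1) the vorticity is parallel to a fixed
nonzero direction, or (2) the slice is invariant under translations along a line, or (3) it is axisymmetric without
swirl about some axis (any direction, any centre), or (4) its vorticity is an affine screw field on a ball. -/
def SliceQuadrichotomy : Prop :=
  ∀ (C : ℝ) (v : ℝ → EuclideanSpace ℝ (Fin 3) → EuclideanSpace ℝ (Fin 3)), FrobeniusClass C v →
    ∃ s < 0,
      (∃ b : EuclideanSpace ℝ (Fin 3), b ≠ 0 ∧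
        ∀ y, Literature.Analysis.FluidPDE.cross (Literature.Analysis.FluidPDE.curl (v s) y) b = 0) ∨
      (∃ e : EuclideanSpace ℝ (Fin 3), e ≠ 0 ∧ ∀ (y : EuclideanSpace ℝ (Fin 3)) (l : ℝ), v s (y + l • e) = v s y) ∨
      (∃ (L : EuclideanSpace ℝ (Fin 3) ≃ₗᵢ[ℝ] EuclideanSpace ℝ (Fin 3)) (c : EuclideanSpace ℝ (Fin 3)),
        Literature.Analysis.FluidPDE.IsAxisymmetric (fun y => L.symm (v s (L y + c))) ∧
        Literature.Analysis.FluidPDE.HasNoSwirl (fun y => L.symm (v s (L y + c)))) ∨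
      HasScrewVorticityBall v s

/-- SCREW-SLICE RIGIDITY (provable, M): a profile of the Type-I class whose vorticity is an affine screw field on a ball
of some slice is not backward-singular — the slice vorticity is real-analytic on `ℝ³` (`analyticOnNhd_slice_of_oseenMild`),
so the affine identity continues to all of `ℝ³`, where `‖k (d × (y − c) + h d)‖ → ∞` linearly, contradicting the slice
derivative bounds of the class (`exists_norm_iteratedFDeriv_slice_le`) unless `k = 0`. -/
def ScrewSliceRigidity : Prop :=
  ∀ (C : ℝ) (v : ℝ → EuclideanSpace ℝ (Fin 3) → EuclideanSpace ℝ (Fin 3)), FrobeniusClass C v →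
    (∃ s < 0, HasScrewVorticityBall v s) → ¬ Literature.Analysis.FluidPDE.IsBackwardSingularPoint v 0

/-- **stub 1 (OPEN, load-bearing)** — the slice quadrichotomy S12. -/
theorem stub_sliceQuadrichotomy : SliceQuadrichotomy := by
  sorry

/-- **stub 2 (CLOSED)** — screw-slice rigidity, by the tree theorem `screwSliceRigidity` (p472222; the class and
`HasScrewVorticityBall` unfold definitionally to its hypotheses). -/
theorem stub_screwSliceRigidity : ScrewSliceRigidity := fun _ _ hcls hscrew =>
  Summit.NavierStokesRegularity.NavierStokesRegularity.Theorems.LocalHelicityTubeDoorFrobeniusProfileRigidityScrewSlice.screwSliceRigidity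
    hcls hscrew

/-- COMPOSITION (proved, no sorry): the two stubs give the crux — the first three alternatives of the quadrichotomy are
the settled tree strata (`eq_zero_of_aligned`, `nonflatLiouville_of_translate_eq_slice`,
`eq_zero_of_axisymmetric_noSwirl_anyAxis_slice`), the fourth is stub 2. -/
theorem FrobeniusProfileRigidity_of (h₁ : SliceQuadrichotomy) (h₂ : ScrewSliceRigidity) :
    FrobeniusProfileRigidity := by
  intro C v hrate hcont hmild hdiv hhel
  have hcls : FrobeniusClass C v := ⟨hrate, hcont, hmild, hdiv, hhel⟩
  obtain ⟨s, hs, halt⟩ := h₁ C v hcls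
  rcases halt with ⟨b, hb, hal⟩ | ⟨e, he, htr⟩ | ⟨L, c, hax, hsw⟩ | hscrew
  · exact not_backwardSingular_of_zero (eq_zero_of_aligned hrate hcont hmild hdiv hb hs hal)
  · exact nonflatLiouville_of_translate_eq_slice hrate hcont hmild hdiv hs he htr
  · exact not_backwardSingular_of_zero
      (eq_zero_of_axisymmetric_noSwirl_anyAxis_slice hrate hcont hmild hdiv L c hs hax hsw)
  · exact h₂ C v hcls ⟨s, hs, hscrew⟩

/-- The crux from the stubs (sorries live only in `stub_*`). -/
theorem FrobeniusProfileRigidity_of_stubs : FrobeniusProfileRigidity :=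
  FrobeniusProfileRigidity_of stub_sliceQuadrichotomy stub_screwSliceRigidity


end

end Summit.NavierStokesRegularity.NavierStokesRegularity.Cruxes.FrobeniusProfileRigidity.Birth
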